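import Literature.MathematicalPhysics.QuantumFieldTheory.Balaban1983to89.B14Eq356FieldStrength

/-!
# `Balaban1983to89.B14.Eq367Assembly` — T. Bałaban, *Convergent renormalization expansions for lattice gauge
# theories*, Commun. Math. Phys. **119** (1988) 243–285 [Balaban1988Convergent]: the resummation (3.56) ⇒ (3.57) over
# the localization domains (p. 281) and the per-point assembly (3.61)+(3.64)+(3.66)+(3.48) ⇒ (3.67) ⇒ (2.43) (p. 283)
# — every step that the print performs BETWEEN its displays, kernel-checked, landing in `B14Sect3.Rep367` and
# `B14Thm2.Ineq243`

statement-level skeleton of published theorems with citation tags; proofs where landed; nothing here is a claim about the Yang–Mills mass gap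

PDF held: `paper:balaban1988-cmp119-convergent-renormalization` (journal page = PDF page + 242); pp. 279–283 [PDF 37–41] read from
the OCR text layer and the x2 renders `…-p038-x2.png` … `…-p041-x2.png` of the cell `pub-balaban`.

CITATION HEADER (lean-in-tree rule).  WHAT IS REPRODUCED, verbatim.  [Balaban1988Convergent] p. 281: *"The identities
(3.56) hold for the localization domains X satisfying the condition X ⊂ □^{∼2}. We sum up the identities over all such
domains, and we extend the sum on the right-hand side to all domains X ∈ 𝐃_j for the space L^{−j}Z^d, X containing the
point z. The difference between the two sums contributes to the irrelevant terms only, by the bounds (3.48). Thus we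
obtain the identity (3.56) resummed over the domains X, but with the first expression on the right-hand side replaced by
½Σ_{κ<μ,λ<ν} Π^{(j)}_{μν,κλ} tr F_{κμ}(z)F_{λν}(z). (3.57) Here Π^{(j)}_{μν,κλ} = Σ_{x,y} Π^{(j)}_{μν}(x, y, z)(x_κ − z_κ)
(y_λ − z_λ), and the function Π^{(j)}_{μν}(x, y, z) is given by the formula (3.50), but with 𝐄^{(j)}(X, U_j, z) replaced by
𝐄^{(j)}(U_j, z) defined on the whole lattice L^{−j}Z^d."*  p. 283: *"… we have the following conclusion: 𝐄^{(j)}(Λ_j,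
U_k, z) − 𝐄^{(j)}(Λ_j, 1, z) − β_jA(h_z, U_k) = O((LʲL⁻ⁿ)^{5−β}), (3.67) for z ∈ Λ_j⁰∩(Ω_n∖Ω_{n+1}), β > 0. Summing over
z ∈ Λ_j⁰∩Ω w get the inequality (2.43) in Theorem 2 (with 1 − β, β > 0, instead of β < 1). Thus we have proved the
first part of Theorem 2, concerning the functions 𝐄^{(j)}."*  p. 263 (2.45): *"Taking Ω = 𝐁_j(Λ_j), φ = φ_j in (2.43)
…"*; (2.26)–(2.27) p. 259: `𝐄^{(j)}(Λ_j) = Σ_{z∈Λ_j⁰} 𝐄^{(j)}(Λ_j, z)`, `𝐄^{(j)}(Λ_j, z) = Σ_{X∈𝐃_j: z∈X⊂Λ_j} 𝐄^{(j)}(X,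
z)`; (3.65) p. 283: `A(φ_j, U_k) = Σ_{z∈Λ_j⁰} A(h_zφ_j, U_k)`.

SKELETON rows (owner r11): **B14.Eq3.55–3.57** ((3.56) ⇒ (3.57): the resummation over X and the split first/second
class), **B14.Eq3.67** (so far `typed-existing + summation PROVED` = `B14Sect3.Rep367`, a HYPOTHESIS packaging the
per-point terms with their bound, and `B14Sect3.ineq243_of_rep367`), **B14.Thm2** ((2.43)).  WHAT IS PROVED HERE:
§1 the linearity behind *"We sum up the identities over all such domains"*: the second moments and the (3.56)/(3.57)
expression are ADDITIVE in the kernel/coefficient table (`moment2_add`/`moment2_sum`, `expr356_add`/`expr356_sum`), so the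
sum over the first-class domains of the (3.56) main terms IS the (3.57) expression of the summed table, and extending
the X-sum to all domains changes it by the (3.57) expression of the second-class table (`expr356_firstClass_eq`);
§2 the per-point assembly: from the per-point DATA — (2.27) split of the 𝐄-difference at `z` into first class + second
class, (3.49)/(3.56)/(3.57)/(3.61) «first class = β′_j·Q(z) + I₁(z)», (3.66) «A(h_z, U_k) = Q(z) + I₂(z)», (3.64) «β′_j =
β_j», and the three irrelevant-term bounds `|I₁|, |I₂|·|β_j|⁻¹…, |second class| ≤ c_i (L^{j−n})^{5−b}` ((3.49)/(3.66)/(3.48),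
the last = `B14.Eq348SecondClass`) — the per-point term `t(z) = 𝐄 − 𝐄(1) − β_jA(h_z)` obeys `|t(z)| ≤ (c₁ + |β_j|c₂ +
c₃)(L^{j−n})^{5−b}` (`perPoint367`); §3 *"Summing over z … we get the inequality (2.43)"*: a per-point data family for
every `(j, k, Ω)` of a run `S : B14.Sect2Data` with the point count of p. 263 YIELDS `B14Sect3.Rep367 S L c (b)` and hence
`B14Thm2.Ineq243 S L (1 − b) c` (`rep367_of_pointData`, `ineq243_of_pointData`) — Theorem 2's first conjunct from the
named display-level inputs, the constant `E₁ = c₁ + βc₂ + c₃` explicit (`β` a uniform bound of `|β_j|`).  NOT HERE: that Bałaban's functions satisfy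
the per-point data (the analytic content of pp. 279–283 and of [I] §§4–5).  Theorems only; no `sorry`.

Mega-formalization `lit-balaban`, unit `lit-balaban-r11` gen 5 (B14 fold owner), HOME `run/shared/lean/pub/lit-balaban/`.

## References
* [Balaban1988Convergent] T. Bałaban, Commun. Math. Phys. 119 (1988) 243–285, (2.26)–(2.27) p.259, (2.43) p.263,
  (3.48) p.280, (3.56)–(3.57) p.281, (3.61) p.282, (3.64)–(3.67) p.283.
-/

namespace Literature.MathematicalPhysics.QuantumFieldTheory.Balaban1983to89.B14.Eq367Assembly

open Finset Matrix
open Literature.MathematicalPhysics.QuantumFieldTheory.Balaban1983to89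
open Literature.MathematicalPhysics.QuantumFieldTheory.Balaban1983to89.B14.Eq356FieldStrength

/-! ## §1. (3.56) ⇒ (3.57): additivity in the localization domains -/

section Resummation

variable {d : ℕ} {X : Type*} {n : Type*} [Fintype n]

/-- The second moments (3.57) are additive in the kernel table: `Π[K₁ + K₂] = Π[K₁] + Π[K₂]`.
[cite: Balaban1988Convergent, (3.57) p.281] -/
theorem moment2_add (s : Finset (X × X)) (K₁ K₂ : Fin d → Fin d → X → X → ℝ) (coord : X → Fin d → ℝ) (z : X)
    (μ ν κ τ : Fin d) :
    moment2 s (fun a b x y => K₁ a b x y + K₂ a b x y) coord z μ ν κ τ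
      = moment2 s K₁ coord z μ ν κ τ + moment2 s K₂ coord z μ ν κ τ := by
  simp only [moment2, add_mul, Finset.sum_add_distrib]

/-- *"We sum up the identities over all such domains"*: the second moments of a finite sum of kernel tables (one per
localization domain `X ∋ z`) are the sum of the second moments. [cite: Balaban1988Convergent, (3.57) p.281] -/
theorem moment2_sum {D : Type*} (𝒳 : Finset D) (s : Finset (X × X)) (K : D → Fin d → Fin d → X → X → ℝ)
    (coord : X → Fin d → ℝ) (z : X) (μ ν κ τ : Fin d) :
    moment2 s (fun a b x y => ∑ X' ∈ 𝒳, K X' a b x y) coord z μ ν κ τ = ∑ X' ∈ 𝒳, moment2 s (K X') coord z μ ν κ τ := by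
  simp only [moment2, Finset.sum_mul]
  rw [Finset.sum_comm]

/-- The (3.56)/(3.57) expression is additive in the coefficient table. [cite: Balaban1988Convergent, (3.56)–(3.57) p.281] -/
theorem expr356_add (E₁ E₂ : Fin d → Fin d → Fin d → Fin d → ℝ) (dB : Fin d → Fin d → Matrix n n ℂ)
    (B : Fin d → Matrix n n ℂ) :
    expr356 (fun μ ν κ τ => E₁ μ ν κ τ + E₂ μ ν κ τ) dB B = expr356 E₁ dB B + expr356 E₂ dB B := by
  unfold expr356
  simp only [← Finset.sum_add_distrib]
  refine Finset.sum_congr rfl fun μ _ => Finset.sum_congr rfl fun κ _ => Finset.sum_congr rfl fun ν _ =>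
    Finset.sum_congr rfl fun τ _ => ?_
  split_ifs <;> ring

/-- The (3.56)/(3.57) expression of a finite sum of coefficient tables is the sum of the expressions.
[cite: Balaban1988Convergent, (3.56)–(3.57) p.281] -/
theorem expr356_sum {D : Type*} (𝒳 : Finset D) (E : D → Fin d → Fin d → Fin d → Fin d → ℝ)
    (dB : Fin d → Fin d → Matrix n n ℂ) (B : Fin d → Matrix n n ℂ) :
    expr356 (fun μ ν κ τ => ∑ X' ∈ 𝒳, E X' μ ν κ τ) dB B = ∑ X' ∈ 𝒳, expr356 (E X') dB B := by
  classical
  induction 𝒳 using Finset.induction_on with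
  | empty =>
      simp only [Finset.sum_empty]
      unfold expr356
      simp
  | insert a s ha ih =>
      rw [Finset.sum_insert ha, ← ih, ← expr356_add]
      congr 1
      funext μ ν κ τ
      rw [Finset.sum_insert ha]

/-- **(3.56) summed over the first class = (3.57) of the whole-lattice table minus the second-class contribution**: with the
domains `X ∋ z` split by a predicate `first` (X ⊂ □^{∼2}) and the whole-lattice table `Σ_X E_X`, `Σ_{X first} expr356(E_X) =
expr356(Σ_X E_X) − Σ_{X ¬first} expr356(E_X)` — *"we extend the sum on the right-hand side to all domains … The difference
between the two sums contributes to the irrelevant terms only"*. [cite: Balaban1988Convergent, (3.56)–(3.57) p.281] -/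
theorem expr356_firstClass_eq {D : Type*} (𝒳 : Finset D) (first : D → Prop) [DecidablePred first]
    (E : D → Fin d → Fin d → Fin d → Fin d → ℝ) (dB : Fin d → Fin d → Matrix n n ℂ) (B : Fin d → Matrix n n ℂ) :
    ∑ X' ∈ 𝒳.filter first, expr356 (E X') dB B
      = expr356 (fun μ ν κ τ => ∑ X' ∈ 𝒳, E X' μ ν κ τ) dB B
        - ∑ X' ∈ 𝒳.filter (fun X' => ¬ first X'), expr356 (E X') dB B := by
  rw [expr356_sum, ← Finset.sum_filter_add_sum_filter_not 𝒳 first]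
  ring

end Resummation

/-! ## §2. The per-point assembly (3.67) -/

section PerPoint

/-- **(3.67) at one point `z`** (p. 283), assembled from the named display-level inputs: the 𝐄-difference at `z` split by
(2.27) into the first-class sum `F` and the second-class sum `G`; `F = β′·Q + I₁` ((3.49) ⇒ (3.56) ⇒ (3.57) ⇒ (3.61), `Q =
½Σ_{μ<ν} tr F²_{μν}(z)`); `A = Q + I₂` ((3.66)); `β′ = β` ((3.64)); and the irrelevant-term bounds `|I₁| ≤ c₁w`, `|I₂| ≤
c₂w`, `|G| ≤ c₃w` ((3.49)/(3.66)/(3.48), `w = (LʲL⁻ⁿ)^{5−b}`): then `|(F + G) − β·A| ≤ (c₁ + |β|c₂ + c₃)·w`.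
[cite: Balaban1988Convergent, (3.67) p.283] -/
theorem perPoint367 {F G A Q I₁ I₂ β β' c₁ c₂ c₃ w : ℝ} (hF : F = β' * Q + I₁) (hA : A = Q + I₂) (h364 : β' = β)
    (hI₁ : |I₁| ≤ c₁ * w) (hI₂ : |I₂| ≤ c₂ * w) (hG : |G| ≤ c₃ * w) :
    |(F + G) - β * A| ≤ (c₁ + |β| * c₂ + c₃) * w := by
  have e : (F + G) - β * A = I₁ - β * I₂ + G := by rw [hF, hA, h364]; ring
  rw [e]
  calc |I₁ - β * I₂ + G| ≤ |I₁ - β * I₂| + |G| := abs_add_le _ _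
    _ ≤ (|I₁| + |β * I₂|) + |G| := add_le_add (abs_sub _ _) le_rfl
    _ = |I₁| + |β| * |I₂| + |G| := by rw [abs_mul]
    _ ≤ c₁ * w + |β| * (c₂ * w) + c₃ * w :=
        add_le_add (add_le_add hI₁ (mul_le_mul_of_nonneg_left hI₂ (abs_nonneg β))) hG
    _ = (c₁ + |β| * c₂ + c₃) * w := by ring

end PerPoint

/-! ## §3. "Summing over z … we get the inequality (2.43)": landing in `B14Sect3.Rep367` / `B14Thm2.Ineq243` -/

section Summation

/-- **(3.67) ⇒ `Rep367`**: if for every `(j, k, Ω)` of the run the left-hand side `S.eTerm j k ω` of (2.43) is the sum over a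
finite set of points `z` (scales `n = sc z ∈ [j, k]`, at most `(L^{n−j})⁴|Γ_n∩Ω|` points of scale `n`, p. 263) of per-point
terms carrying the data of `perPoint367` with `w = (L^{j−n})^{5−b}` and constants `c₁, c₂, c₃` uniform in the point, then
`B14Sect3.Rep367 S L (c₁ + βc₂ + c₃) b` holds, `β` a uniform bound of the coefficients `|β_j|` over the points. [cite: Balaban1988Convergent, (3.67) p.283] -/
theorem rep367_of_pointData (S : B14.Sect2Data) (L c₁ c₂ c₃ β b : ℝ) (hc₂ : 0 ≤ c₂)
    (hdata : ∀ j k ω, 1 ≤ j → j ≤ k → k ≤ S.K →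
      ∃ (Z : Finset ℕ) (sc : ℕ → ℕ) (F G A Q I₁ I₂ βj β' : ℕ → ℝ),
        S.eTerm j k ω = ∑ z ∈ Z, ((F z + G z) - βj z * A z) ∧
        (∀ z ∈ Z, j ≤ sc z ∧ sc z ≤ k) ∧
        (∀ z ∈ Z, F z = β' z * Q z + I₁ z ∧ A z = Q z + I₂ z ∧ β' z = βj z ∧ |βj z| ≤ β ∧
          |I₁ z| ≤ c₁ * (L ^ ((j : ℝ) - sc z)) ^ (5 - b) ∧ |I₂ z| ≤ c₂ * (L ^ ((j : ℝ) - sc z)) ^ (5 - b) ∧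
          |G z| ≤ c₃ * (L ^ ((j : ℝ) - sc z)) ^ (5 - b)) ∧
        (∀ n, ((Z.filter (fun z => sc z = n)).card : ℝ) ≤ (L ^ ((n : ℝ) - j)) ^ (4 : ℝ) * S.gammaVol n ω))
    (hL : 0 < L) :
    B14Sect3.Rep367 S L (c₁ + β * c₂ + c₃) b := by
  intro j k ω hj hjk hkK
  obtain ⟨Z, sc, F, G, A, Q, I₁, I₂, βj, β', hsum, hsc, hpt, hcount⟩ := hdata j k ω hj hjk hkK
  refine ⟨Z, sc, fun z => (F z + G z) - βj z * A z, hsum, hsc, ?_, hcount⟩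
  intro z hz
  obtain ⟨hF, hA, h364, hβ, hI₁, hI₂, hG⟩ := hpt z hz
  have hw : 0 ≤ (L ^ ((j : ℝ) - sc z)) ^ (5 - b) := Real.rpow_nonneg (Real.rpow_nonneg hL.le _) _
  have h := perPoint367 hF hA h364 hI₁ hI₂ hG
  refine h.trans (mul_le_mul_of_nonneg_right ?_ hw)
  nlinarith [abs_nonneg (βj z), mul_le_mul_of_nonneg_right hβ hc₂]

/-- **"Summing over z ∈ Λ_j⁰∩Ω w[e] get the inequality (2.43) in Theorem 2 (with 1 − β, β > 0, instead of β < 1)"**: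
the per-point data give (2.43) in the cell's typed form `B14Thm2.Ineq243 S L (1 − b) (c₁ + βc₂ + c₃)` — via
`rep367_of_pointData` and `B14Sect3.ineq243_of_rep367`. [cite: Balaban1988Convergent, (2.43) p.263, (3.67) p.283] -/
theorem ineq243_of_pointData (S : B14.Sect2Data) (L c₁ c₂ c₃ β b : ℝ) (hL : 0 < L) (hc₁ : 0 ≤ c₁) (hc₂ : 0 ≤ c₂)
    (hc₃ : 0 ≤ c₃) (hβ0 : 0 ≤ β)
    (hdata : ∀ j k ω, 1 ≤ j → j ≤ k → k ≤ S.K →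
      ∃ (Z : Finset ℕ) (sc : ℕ → ℕ) (F G A Q I₁ I₂ βj β' : ℕ → ℝ),
        S.eTerm j k ω = ∑ z ∈ Z, ((F z + G z) - βj z * A z) ∧
        (∀ z ∈ Z, j ≤ sc z ∧ sc z ≤ k) ∧
        (∀ z ∈ Z, F z = β' z * Q z + I₁ z ∧ A z = Q z + I₂ z ∧ β' z = βj z ∧ |βj z| ≤ β ∧
          |I₁ z| ≤ c₁ * (L ^ ((j : ℝ) - sc z)) ^ (5 - b) ∧ |I₂ z| ≤ c₂ * (L ^ ((j : ℝ) - sc z)) ^ (5 - b) ∧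
          |G z| ≤ c₃ * (L ^ ((j : ℝ) - sc z)) ^ (5 - b)) ∧
        (∀ n, ((Z.filter (fun z => sc z = n)).card : ℝ) ≤ (L ^ ((n : ℝ) - j)) ^ (4 : ℝ) * S.gammaVol n ω)) :
    B14Thm2.Ineq243 S L (1 - b) (c₁ + β * c₂ + c₃) :=
  B14Sect3.ineq243_of_rep367 S L (c₁ + β * c₂ + c₃) b hL (by positivity)
    (rep367_of_pointData S L c₁ c₂ c₃ β b hc₂ hdata hL)

end Summation

end Literature.MathematicalPhysics.QuantumFieldTheory.Balaban1983to89.B14.Eq367Assembly
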